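import Summits.SmoothPoincare4.SmoothPoincare4.Theses.SymplecticOrigami
import Summits.SmoothPoincare4.SmoothPoincare4.Theses.SymplecticCap
import Summits.SmoothPoincare4.SmoothPoincare4.Theorems.SymplecticOrigamiGromovRecognitionRelEndStubFlatLeavesAux3
import Summits.SmoothPoincare4.SmoothPoincare4.Theorems.SymplecticOrigamiGromovRecognitionRelEndStubFlatLeavesAux4
import Summits.SmoothPoincare4.SmoothPoincare4.Theorems.SymplecticOrigamiGromovRecognitionRelEndStubFlatLeavesAux5
import Literature.Geometry.Symplectic.AlmostComplexStructure
import Literature.Geometry.Symplectic.GromovR4RelEnd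
import Literature.Geometry.Symplectic.ExactNoJSpheres
import Literature.Geometry.Symplectic.PlanarExactDensityDecay

/-!
# Stub `stub_flatLeaves` of line `cross-cap-laurent` (crux `GromovRecognitionRelEnd`, item stmt-SmoothPoincare4-11009)

Work file generated by the lead (c1) from the registered skeleton `Lines/cross_cap_laurent.lean`; the
statement below is the REGISTERED signature (prove exactly this, same name, same namespace).

The proof is assembled from the five auxiliary files `…StubFlatLeavesAux{,2,3,4,5}.lean`:
`Aux` (smooth inverse of the injective local diffeomorphisms `ηH`, `ηV` on their open coordinate
domains, holomorphicity of the inverse), `Aux2` (flat lines as `JX`-holomorphic slices of the cap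
charts, the chart at infinity), `Aux3` (leaf constancy: the Jacobian of `z₁ ∘ ηH⁻¹ ∘ lamV` along a
`JX`-sphere is pointwise `β |∂ₓ|² ≥ 0`, so the planar lemma `hdet` = `stub_sphereDetVanishes` forces
`d(lamV ∘ u) = 0`), `Aux4` (the flat line `{z₁ = c}` as a `JX`-sphere adapted to `lamV`,
`FlatLeaves.flatLeaf_V_sphere`) and `Aux5` (the mirror `H` case `FlatLeaves.flatLeaf_H_sphere`); here
the cap block is destructured and, in each case, leaf constancy is applied to that sphere.
-/

noncomputable section

-- the prescribed namespace `Summit.<P>.<Sub>.…` duplicates `SmoothPoincare4` (P = Sub)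
set_option linter.dupNamespace false

open scoped Manifold ContDiff Topology
open Set TopologicalSpace Literature.Geometry.Kaehler Literature.Geometry.Symplectic

namespace Summit.SmoothPoincare4.SmoothPoincare4.Theorems.GromovRecognitionRelEnd.CrossCapLaurent

/-- Model space `ℝ⁴ = ℂ²` (coordinates `0,1` = `z₁`, `2,3` = `z₂`). -/
local notation "E4" => EuclideanSpace ℝ (Fin 4)
/-- `ℝ² = ℂ`, the coordinate plane of one factor. -/
local notation "E2" => EuclideanSpace ℝ (Fin 2)

/-- **Registered helper sub-goal `helper_flatLeavesChartDomainsOpen`** (landing vehicle of this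
file: the registered signature of `stub_flatLeaves` below exceeds the registry's 4000-character
limit and is stored truncated, so the gate can only match this short companion): the coordinate
domains `{|z₂| < R₁⁻¹}` of `ηH` and `{|z₁| < R₁⁻¹}` of `ηV` are open in `ℝ⁴`. [folklore] -/
theorem helper_flatLeavesChartDomainsOpen : ∀ R₁ : ℝ,
    IsOpen {p : EuclideanSpace ℝ (Fin 4) | p 2 ^ 2 + p 3 ^ 2 < R₁⁻¹ ^ 2} ∧
      IsOpen {p : EuclideanSpace ℝ (Fin 4) | p 0 ^ 2 + p 1 ^ 2 < R₁⁻¹ ^ 2} :=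
  fun _ => ⟨isOpen_lt CapModel.continuous_r2 continuous_const,
    isOpen_lt CapModel.continuous_r1 continuous_const⟩

/-- **Stub 4d — the flat lines are leaves (M/L; Gromov 1985 2.4.A₂′ "suppose the form has been already
split near S₁ ∪ S₂", here: `J` is already the product `i ⊕ i` beyond `R₁`).**  Given the cap block, two
smooth retractions `lamV`, `lamH` with the listed properties (output of `stub_biFoliationCore`: into
`H∞`/`V∞`, identity on the affine axes, corner criterion, `JX`-invariant kernels, positive holonomy) and
the analytic lemma `stub_sphereDetVanishes` (fed in verbatim as the hypothesis `hdet`), the `V`-leaf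
through `ι χ w` with `|z₁(w)| > R₁` is the FLAT line `{z₁ = z₁(w)}`: `lamV (ι χ w) = ηH (w₀, w₁, 0, 0)`, and
symmetrically `lamH (ι χ w) = ηV (0, 0, w₂, w₃)` for `|z₂(w)| > R₁`.  Proof plan (V case; `c := (w₀, w₁)`):
(1) the flat line as a `JX`-sphere in two charts: `u z := ι χ (c, z)` (`‖(c, z)‖ ≥ |c| > R₁ > R`, so smooth by
H7 and the cap block; `JX`-holomorphic because `J = ψ^*(i ⊕ i)` there (hJstd, with `ψ ∘ χ = id` from
H8/H9 and `dχ = (dψ)⁻¹` from H6) and `ι` is holomorphic), `v z := ηH (c, z)` for `|z| < R₁⁻¹`, `:= u (1/z)`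
otherwise (they agree on the overlap by the cap clause `ηH (c, t) = ι χ (c, 1/t)`; `v` is `JX`-holomorphic
by the `ηH`-clause); `u (ℂ) ⊂ range ι` misses `V∞` (cap block: axis points and the corner are not in
`range ι`), so by the corner criterion `lamV ∘ u`, `lamV ∘ v` take values in the affine part `ηH(axis)`;
(2) `θ := (p₀ + i p₁) ∘ ηH⁻¹` on the open `ηH {p₂² + p₃² < R₁⁻²}` is smooth (injective local diffeo ⇒
smooth inverse on the image) and `JX`-HOLOMORPHIC AS A FUNCTION (`ηH` intertwines `i ⊕ i` and `JX`);
along `lamV` the companion `(p₂ + i p₃) ∘ ηH⁻¹ ∘ lamV ≡ 0`, so `dθ` is injective on `im (d lamV)`;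
(3) `g := θ ∘ lamV ∘ u`, `h := θ ∘ lamV ∘ v`: smooth, `h z = g (1/z)`, and POINTWISE
`det Dg_z = β ‖dg_z 1‖² ≥ 0` (invariant kernel + positive holonomy + holomorphy of `θ`, `u`); (4) `hdet`
⇒ `det Dg ≡ 0` ⇒ `d(lamV ∘ u) ≡ 0` ⇒ `lamV ∘ u` constant (`apply_eq_apply_zero_of_mfderiv_eq_zero`)
`= lamV (v 0) = lamV (ηH (c, 0)) = ηH (c, 0)` (retraction).  Leans on: cap block, hJstd, H6–H9,
`Literature.Geometry.Symplectic.IsJHolomorphic`, `ExactNoJSpheres` chart lemmas, landed cap-chart calculus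
(`CapModelAux*`: `inv1/inv2`, `fderiv_inv1_I4`), smooth-inverse lemmas (`CapModelGlueACS.contMDiffAt_invFun`).
[cite: Gromov1985, 2.4.A₂′] -/
theorem stub_flatLeaves :
    ∀ (M : Type) [TopologicalSpace M] [T2Space M] [SecondCountableTopology M]
      [ChartedSpace E4 M] [IsManifold (𝓡 4) ∞ M] [ConnectedSpace M]
      (J : AlmostComplexStructure (𝓡 4) ∞ M) (K : Set M) (R R₁ : ℝ) (ψ : M → E4) (χ : E4 → M),
      ContMDiffOn (𝓡 4) 𝓘(ℝ, E4) ∞ ψ Kᶜ →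
      ContMDiffOn 𝓘(ℝ, E4) (𝓡 4) ∞ χ (Metric.closedBall (0 : E4) R)ᶜ →
      Set.BijOn ψ Kᶜ (Metric.closedBall (0 : E4) R)ᶜ →
      (∀ x, x ∈ Kᶜ → χ (ψ x) = x) →
      R < R₁ → 0 < R₁ →
      (∀ x, x ∈ Kᶜ → R₁ < ‖ψ x‖ → ∀ (v : TangentSpace (𝓡 4) x) (a : E4),
          a = mfderiv (𝓡 4) 𝓘(ℝ, E4) ψ x v →
          mfderiv (𝓡 4) 𝓘(ℝ, E4) ψ x (J x v) = WithLp.toLp 2 ![-(a 1), a 0, -(a 3), a 2]) →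
      ∀ (X : Type) [TopologicalSpace X] [T2Space X] [SecondCountableTopology X] [CompactSpace X]
        [ConnectedSpace X] [ChartedSpace E4 X] [IsManifold (𝓡 4) ∞ X]
        (ωX : MForm (𝓡 4) X ℝ 2) (JX : AlmostComplexStructure (𝓡 4) ∞ X) (ι : M → X)
        (ηH ηV ηC : E4 → X),
        (IsSmoothForm ωX ∧ IsClosedForm ωX ∧ JX.IsTamedBy ωX) ∧
        (IsLocalDiffeomorph (𝓡 4) (𝓡 4) ∞ ι ∧ Function.Injective ι ∧
          ∀ (x : M) (v : TangentSpace (𝓡 4) x),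
            JX (ι x) (mfderiv (𝓡 4) (𝓡 4) ι x v) = mfderiv (𝓡 4) (𝓡 4) ι x (J x v)) ∧
        (IsLocalDiffeomorphOn 𝓘(ℝ, E4) (𝓡 4) ∞ ηV {p : E4 | p 0 ^ 2 + p 1 ^ 2 < R₁⁻¹ ^ 2} ∧
          Set.InjOn ηV {p : E4 | p 0 ^ 2 + p 1 ^ 2 < R₁⁻¹ ^ 2} ∧
          (∀ p : E4, p 0 ^ 2 + p 1 ^ 2 < R₁⁻¹ ^ 2 → (p 0 ≠ 0 ∨ p 1 ≠ 0) →
            ηV p = ι (χ (WithLp.toLp 2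
              ![p 0 / (p 0 ^ 2 + p 1 ^ 2), -(p 1) / (p 0 ^ 2 + p 1 ^ 2), p 2, p 3]))) ∧
          (∀ p : E4, p 0 = 0 → p 1 = 0 → ηV p ∉ Set.range ι) ∧
          (∀ p : E4, p 0 ^ 2 + p 1 ^ 2 < R₁⁻¹ ^ 2 → ∀ q : E4,
            JX (ηV p) (mfderiv 𝓘(ℝ, E4) (𝓡 4) ηV p q) =
              mfderiv 𝓘(ℝ, E4) (𝓡 4) ηV p (WithLp.toLp 2 ![-(q 1), q 0, -(q 3), q 2]))) ∧
        (IsLocalDiffeomorphOn 𝓘(ℝ, E4) (𝓡 4) ∞ ηH {p : E4 | p 2 ^ 2 + p 3 ^ 2 < R₁⁻¹ ^ 2} ∧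
          Set.InjOn ηH {p : E4 | p 2 ^ 2 + p 3 ^ 2 < R₁⁻¹ ^ 2} ∧
          (∀ p : E4, p 2 ^ 2 + p 3 ^ 2 < R₁⁻¹ ^ 2 → (p 2 ≠ 0 ∨ p 3 ≠ 0) →
            ηH p = ι (χ (WithLp.toLp 2
              ![p 0, p 1, p 2 / (p 2 ^ 2 + p 3 ^ 2), -(p 3) / (p 2 ^ 2 + p 3 ^ 2)]))) ∧
          (∀ p : E4, p 2 = 0 → p 3 = 0 → ηH p ∉ Set.range ι) ∧
          (∀ p : E4, p 2 ^ 2 + p 3 ^ 2 < R₁⁻¹ ^ 2 → ∀ q : E4,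
            JX (ηH p) (mfderiv 𝓘(ℝ, E4) (𝓡 4) ηH p q) =
              mfderiv 𝓘(ℝ, E4) (𝓡 4) ηH p (WithLp.toLp 2 ![-(q 1), q 0, -(q 3), q 2]))) ∧
        (IsLocalDiffeomorphOn 𝓘(ℝ, E4) (𝓡 4) ∞ ηC
            {p : E4 | p 0 ^ 2 + p 1 ^ 2 < R₁⁻¹ ^ 2 ∧ p 2 ^ 2 + p 3 ^ 2 < R₁⁻¹ ^ 2} ∧
          Set.InjOn ηC {p : E4 | p 0 ^ 2 + p 1 ^ 2 < R₁⁻¹ ^ 2 ∧ p 2 ^ 2 + p 3 ^ 2 < R₁⁻¹ ^ 2} ∧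
          (∀ p : E4, p 0 ^ 2 + p 1 ^ 2 < R₁⁻¹ ^ 2 → p 2 ^ 2 + p 3 ^ 2 < R₁⁻¹ ^ 2 →
            (p 2 ≠ 0 ∨ p 3 ≠ 0) →
            ηC p = ηV (WithLp.toLp 2
              ![p 0, p 1, p 2 / (p 2 ^ 2 + p 3 ^ 2), -(p 3) / (p 2 ^ 2 + p 3 ^ 2)])) ∧
          (∀ p : E4, p 0 ^ 2 + p 1 ^ 2 < R₁⁻¹ ^ 2 → p 2 ^ 2 + p 3 ^ 2 < R₁⁻¹ ^ 2 →
            (p 0 ≠ 0 ∨ p 1 ≠ 0) →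
            ηC p = ηH (WithLp.toLp 2
              ![p 0 / (p 0 ^ 2 + p 1 ^ 2), -(p 1) / (p 0 ^ 2 + p 1 ^ 2), p 2, p 3])) ∧
          ηC 0 ∉ Set.range ι ∧
          (∀ p : E4, p 0 ^ 2 + p 1 ^ 2 < R₁⁻¹ ^ 2 → p 2 ^ 2 + p 3 ^ 2 < R₁⁻¹ ^ 2 → ∀ q : E4,
            JX (ηC p) (mfderiv 𝓘(ℝ, E4) (𝓡 4) ηC p q) =
              mfderiv 𝓘(ℝ, E4) (𝓡 4) ηC p (WithLp.toLp 2 ![-(q 1), q 0, -(q 3), q 2]))) ∧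
        (∀ y : X, y ∈ Set.range ι ∨ (∃ p : E4, p 0 ^ 2 + p 1 ^ 2 < R₁⁻¹ ^ 2 ∧ ηV p = y) ∨
          (∃ p : E4, p 2 ^ 2 + p 3 ^ 2 < R₁⁻¹ ^ 2 ∧ ηH p = y) ∨
          (∃ p : E4, (p 0 ^ 2 + p 1 ^ 2 < R₁⁻¹ ^ 2 ∧ p 2 ^ 2 + p 3 ^ 2 < R₁⁻¹ ^ 2) ∧ ηC p = y)) →
        ∀ (lamV lamH : X → X),
        ContMDiff (𝓡 4) (𝓡 4) ∞ lamV →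
        ContMDiff (𝓡 4) (𝓡 4) ∞ lamH →
        (∀ y : X, (∃ p : E4, p 2 = 0 ∧ p 3 = 0 ∧ ηH p = lamV y) ∨ lamV y = ηC 0) →
        (∀ p : E4, p 2 = 0 → p 3 = 0 → lamV (ηH p) = ηH p) →
        (∀ y : X, (∃ q : E4, q 0 = 0 ∧ q 1 = 0 ∧ ηV q = lamH y) ∨ lamH y = ηC 0) →
        (∀ q : E4, q 0 = 0 → q 1 = 0 → lamH (ηV q) = ηV q) →
        (∀ y : X, lamV y = ηC 0 ↔ ((∃ q : E4, q 0 = 0 ∧ q 1 = 0 ∧ ηV q = y) ∨ y = ηC 0)) →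
        (∀ y : X, lamH y = ηC 0 ↔ ((∃ p : E4, p 2 = 0 ∧ p 3 = 0 ∧ ηH p = y) ∨ y = ηC 0)) →
        (∀ (y : X) (v : TangentSpace (𝓡 4) y), mfderiv (𝓡 4) (𝓡 4) lamV y v = 0 →
          mfderiv (𝓡 4) (𝓡 4) lamV y (JX y v) = 0) →
        (∀ (y : X) (v : TangentSpace (𝓡 4) y), mfderiv (𝓡 4) (𝓡 4) lamH y v = 0 →
          mfderiv (𝓡 4) (𝓡 4) lamH y (JX y v) = 0) →
        (∀ (y : X) (v : TangentSpace (𝓡 4) y), mfderiv (𝓡 4) (𝓡 4) lamV y v ≠ 0 →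
          ∃ α β : ℝ, 0 < β ∧ mfderiv (𝓡 4) (𝓡 4) lamV y (JX y v) =
            α • mfderiv (𝓡 4) (𝓡 4) lamV y v + β • JX (lamV y) (mfderiv (𝓡 4) (𝓡 4) lamV y v)) →
        (∀ (y : X) (v : TangentSpace (𝓡 4) y), mfderiv (𝓡 4) (𝓡 4) lamH y v ≠ 0 →
          ∃ α β : ℝ, 0 < β ∧ mfderiv (𝓡 4) (𝓡 4) lamH y (JX y v) =
            α • mfderiv (𝓡 4) (𝓡 4) lamH y v + β • JX (lamH y) (mfderiv (𝓡 4) (𝓡 4) lamH y v)) →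
        (∀ (g h : ℂ → ℂ), ContDiff ℝ ∞ g → ContDiff ℝ ∞ h → (∀ z : ℂ, z ≠ 0 → h z = g z⁻¹) →
            (∀ z : ℂ, 0 ≤ (fderiv ℝ g z 1).re * (fderiv ℝ g z Complex.I).im -
                (fderiv ℝ g z 1).im * (fderiv ℝ g z Complex.I).re) →
            ∀ z : ℂ, (fderiv ℝ g z 1).re * (fderiv ℝ g z Complex.I).im -
                (fderiv ℝ g z 1).im * (fderiv ℝ g z Complex.I).re = 0) →
        (∀ w : E4, R₁ ^ 2 < w 0 ^ 2 + w 1 ^ 2 → lamV (ι (χ w)) = ηH (WithLp.toLp 2 ![w 0, w 1, 0, 0])) ∧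
        (∀ w : E4, R₁ ^ 2 < w 2 ^ 2 + w 3 ^ 2 → lamH (ι (χ w)) = ηV (WithLp.toLp 2 ![0, 0, w 2, w 3])) := by
  intro M _ _ _ _ _ _ J K R R₁ ψ χ _ _ _ _ _ hR₁ _ X _ _ _ _ _ _ _ ωX JX ι ηH ηV ηC hW lamV lamH
    hlamV hlamH hintoV hretV hintoH hretH hcornV hcornH hkerV hkerH hposV hposH hdet
  obtain ⟨-, -, ⟨hVloc, hVinj, hVglue, hVax, hVhol⟩, ⟨hHloc, hHinj, hHglue, hHax, hHhol⟩,
    ⟨hCloc, hCinj, hCV, hCH, hC0, -⟩, -⟩ := hW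
  obtain ⟨hDHo, hDVo⟩ := helper_flatLeavesChartDomainsOpen R₁
  refine ⟨fun w hw => ?_, fun w hw => ?_⟩
  · -- the `V` case: the flat line `{z₁ = (w₀, w₁)}` is a `JX`-sphere through `ι χ w` and `ηH (c, 0)`
    obtain ⟨π₁, π₂, S, u, v, hπ₁I, hπ, hS, hSax, hu, hv, huv, huhol, huS, hvS, hub, hv0⟩ :=
      FlatLeaves.flatLeaf_V_sphere (fun y => JX y) ι χ ηH ηV ηC hR₁ hVloc hVglue hVax hVhol hCloc
        hCinj hCV hCH hC0 lamV hlamV hintoV hretV hcornV w hw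
    -- leaf constancy along it, read in the chart `ηH` of `H∞`
    have key := FlatLeaves.leaf_const (JX := fun y => JX y) hlamV hkerV hposV hDHo hHloc hHinj
      (fun p hp q => hHhol p hp q) hπ₁I hπ hS hSax hu hv huv huhol huS hvS hdet ⟨w 2, w 3⟩
    rw [hub, hv0] at key
    exact key
  · -- the `H` case: the flat line `{z₂ = (w₂, w₃)}` is a `JX`-sphere through `ι χ w` and `ηV (0, c)`
    obtain ⟨π₁, π₂, S, u, v, hπ₁I, hπ, hS, hSax, hu, hv, huv, huhol, huS, hvS, hub, hv0⟩ :=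
      FlatLeaves.flatLeaf_H_sphere (fun y => JX y) ι χ ηH ηV ηC hR₁ hHloc hHglue hHax hHhol hCloc
        hCinj hCV hCH hC0 lamH hlamH hintoH hretH hcornH w hw
    -- leaf constancy along it, read in the chart `ηV` of `V∞`
    have key := FlatLeaves.leaf_const (JX := fun y => JX y) hlamH hkerH hposH hDVo hVloc hVinj
      (fun p hp q => hVhol p hp q) hπ₁I hπ hS hSax hu hv huv huhol huS hvS hdet ⟨w 0, w 1⟩
    rw [hub, hv0] at key
    exact key

end Summit.SmoothPoincare4.SmoothPoincare4.Theorems.GromovRecognitionRelEnd.CrossCapLaurent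

end
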